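import Summits.QuantumFields.YangMills.Theorems.BalabanLadderUVSeamRecColdWallLocalisedTilt
import Summits.QuantumFields.YangMills.Theorems.WeakCouplingRatesEventuallyPow
import HarnessLib

/-!
# Crux `UVSeamRec` (stmt-QuantumFields-20043), line «coldwall_pure», stub `stub_classicalDominanceFemtoTail` (SD-tail ≡ CW♭-tail):
# (CW♭) for every exterior on the window `R + 1 ≤ ⌈β^θ⌉`, every `θ < 1/4`, GIVEN a local-response-mean bound

Helper file (`--supports stmt-QuantumFields-20043`) of the successor LEAD seat `ymfull-r2d-prover-2` (gen 0); sequel of `…ColdWallLocalisedTilt`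
(the localised tilt inequality: `|kerE^η_R(plane) − kerE^𝟙_R(plane)| ≤ max(kerE^η_R cr₁^{(r₀)}, kerE^𝟙_R cr₁^{(r₀)}) + 120(2r₀+3)⁴(38 + 12 log β)/β`).

* `localSlop_le_of_window` — a LOCAL slop `R⁴(K₀ + K₁ log β)/β` is below any tolerance on the window `R + 1 ≤ ⌈β^θ⌉` for every `θ < 1/4`
  (compare LEAD g16's `slop_le_of_window`: the whole-box slop `∝ R⁸ log β/β` needs `θ < 1/8`).
* `coldWallSplitFlat_window_of_localResponseMean` — **(CW♭) «`(R⁴/C₁)|kerE^η(plane q x) − kerE^𝟙(plane q x)| ≤ A₂ + carrierCl C_s 1 1 R q x η`» holds for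
  EVERY exterior on the window `r₀ ≤ R`, `R + 1 ≤ ⌈β^θ⌉`, every `θ < 1/4`, GIVEN the local-response-mean bound**
  `kerE^η_R(cr₁^{(r₀)}) ≤ K/β + K'·cr₁^{(R)}(η)` for every exterior (local equipartition at the centre + classical domination of the mean radius-`r₀`
  response by the radius-`R` response of the exterior; at `η = 𝟙` it reads `kerE^𝟙_R(cr₁^{(r₀)}) ≤ K/β`, an `R`-UNIFORM local thermal ceiling).  The
  hypothesis is NOT proved here or anywhere in the tree; it is the located price of the window `[β^{1/8}, β^{1/4})`.  Beyond `β^{1/4}` no hypothesis of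
  this kind helps (`…ColdWallLocalisedTilt` §4: two thermal floors): the femto tail of the stub needs the cancellation of the two thermal deficits.
* `abs_kerE_plane_sub_eventually_le` (every compact `G`) ∕ `coldWallSplitFlat_eventually_fixed` (`SU(2)`, the stub's letters) — the ZERO-TEMPERATURE
  SKELETON: at every FIXED cube and exterior, (CW♭) holds eventually in `β` with `C_s = C₁` and ANY `A₂ > 0` (Laplace step
  `kerE_plane_eventually_ge_sub_classicalResponse` at `η` and at `𝟙`); the stub's whole content is UNIFORMITY (in `η`, and in `R ≤ ℓ₂/uRec β`).

HONEST FRAMING: a conditional window statement assembled from landed lemmas; (SD-tail), (CM-tail) and the NT floors stay OPEN; nothing of E0′, NT or a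
gap is claimed; finite-volume ∕ conditional; the Yang–Mills mass gap is NOT proved; not Clay.
-/

set_option autoImplicit false

noncomputable section

open MeasureTheory Finset Filter
open Literature.MathematicalPhysics.QuantumFieldTheory (LatticeRep)
open Literature.MathematicalPhysics.QuantumLattice (LGConfig fundamentalLatticeRep)
open Summit.QuantumFields.YangMills.Cruxes.OSLegsFromFemtoAndGap.DlrCollarTransfer (cubeEdges depth kerE plane continuous_plane depth_centred)
open Summit.QuantumFields.YangMills.Theorems.WeakCouplingRates (exists_const_mul_boxSide_pow_mul_rpow_le)

namespace Summit.QuantumFields.YangMills.Cruxes.UVSeamRec.ClassicalResponse.ColdWall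

/-- `(K₀ + K₁ log β)/β ≤ (K₀ + K₁/ε)·β^{ε − 1}` for `β ≥ 1`, `ε > 0`, `K₀, K₁ ≥ 0` (`log β ≤ β^ε/ε`). [folklore] -/
theorem affineLog_ratio_le_rpow {β ε K₀ K₁ : ℝ} (hβ : 1 ≤ β) (hε : 0 < ε) (hK₀ : 0 ≤ K₀) (hK₁ : 0 ≤ K₁) :
    (K₀ + K₁ * Real.log β) / β ≤ (K₀ + K₁ / ε) * β ^ (ε - 1) := by
  have hβ0 : 0 < β := by linarith
  have h1 : Real.log β ≤ β ^ ε / ε := Real.log_le_rpow_div hβ0.le hε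
  have h2 : 1 ≤ β ^ ε := Real.one_le_rpow hβ hε.le
  have h3 : β ^ (ε - 1) = β ^ ε / β := Real.rpow_sub_one hβ0.ne' ε
  rw [h3, ← mul_div_assoc, div_le_div_iff_of_pos_right hβ0]
  have h4 : K₁ * Real.log β ≤ K₁ / ε * β ^ ε := by
    have := mul_le_mul_of_nonneg_left h1 hK₁
    calc K₁ * Real.log β ≤ K₁ * (β ^ ε / ε) := this
      _ = K₁ / ε * β ^ ε := by ring
  have h5 : 0 ≤ K₁ / ε := div_nonneg hK₁ hε.le
  nlinarith [h2, h4, h5]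

/-- **A LOCAL slop is below any fixed tolerance on the window `R + 1 ≤ ⌈β^θ⌉` for every `θ < 1/4`**: for `K > 0`, `K₀, K₁ ≥ 0` there is `β₀ ≥ 1` with
`R⁴·(K₀ + K₁ log β)/β ≤ K` for all `β ≥ β₀`, `R + 1 ≤ ⌈β^θ⌉` (`R⁴ ≤ (2⌈β^θ⌉+3)⁴`, `ε = (1 − 4θ)/2`, `4θ + ε − 1 < 0`).  Compare `slop_le_of_window`
(whole-box slop `∝ R⁸`, `θ < 1/8`). [folklore] -/
theorem localSlop_le_of_window {θ : ℝ} (hθ : 0 < θ) (hθ₄ : θ < 1 / 4) {K₀ K₁ K : ℝ} (hK₀ : 0 ≤ K₀) (hK₁ : 0 ≤ K₁) (hK : 0 < K) :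
    ∃ β₀ : ℝ, 1 ≤ β₀ ∧ ∀ β : ℝ, β₀ ≤ β → ∀ R : ℕ, R + 1 ≤ ⌈β ^ θ⌉₊ →
      (R : ℝ) ^ 4 * ((K₀ + K₁ * Real.log β) / β) ≤ K := by
  set ε : ℝ := (1 - 4 * θ) / 2 with hεdef
  have hε : 0 < ε := by rw [hεdef]; linarith
  obtain ⟨b₁, hb₁1, E1⟩ := exists_const_mul_boxSide_pow_mul_rpow_le ((K₀ + K₁ / ε) / K) 4 (θ := θ) (a := ε - 1) (b := 0) hθ
    (by rw [hεdef]; push_cast; linarith)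
  refine ⟨b₁, hb₁1, fun β hβ R hR => ?_⟩
  have hβ1 : 1 ≤ β := hb₁1.trans hβ
  have hβ0 : 0 < β := by linarith
  set S : ℝ := 2 * (⌈β ^ θ⌉₊ : ℝ) + 3 with hSdef
  have hRS : (R : ℝ) ≤ S := by
    have h : (R : ℝ) + 1 ≤ (⌈β ^ θ⌉₊ : ℝ) := by exact_mod_cast hR
    rw [hSdef]; linarith [(Nat.cast_nonneg R : (0 : ℝ) ≤ R)]
  have hR4 : (R : ℝ) ^ 4 ≤ S ^ 4 := pow_le_pow_left₀ (Nat.cast_nonneg R) hRS 4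
  have hlog := affineLog_ratio_le_rpow hβ1 hε hK₀ hK₁
  have e1 := E1 β hβ
  rw [Real.rpow_zero] at e1
  have hKε : 0 ≤ K₀ + K₁ / ε := by positivity
  have hT0 : 0 ≤ (K₀ + K₁ * Real.log β) / β := div_nonneg (by nlinarith [Real.log_nonneg hβ1]) hβ0.le
  have step1 : (R : ℝ) ^ 4 * ((K₀ + K₁ * Real.log β) / β) ≤ S ^ 4 * ((K₀ + K₁ / ε) * β ^ (ε - 1)) := by
    gcongr
  have step2 : S ^ 4 * ((K₀ + K₁ / ε) * β ^ (ε - 1)) = K * ((K₀ + K₁ / ε) / K * S ^ 4 * β ^ (ε - 1)) := by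
    field_simp
  rw [step2] at step1
  calc _ ≤ K * ((K₀ + K₁ / ε) / K * S ^ 4 * β ^ (ε - 1)) := step1
    _ ≤ K * 1 := mul_le_mul_of_nonneg_left e1 hK.le
    _ = K := mul_one _

/-- **(CW♭) FOR EVERY EXTERIOR ON THE WINDOW `R + 1 ≤ ⌈β^θ⌉`, EVERY `θ < 1/4`, GIVEN A LOCAL-RESPONSE-MEAN BOUND.**  Fix `r₀` and suppose that for
`β ≥ β₀`, `r₀ ≤ R`, `R + 1 ≤ ⌈β^θ⌉`, `q.1 < q.2`, every `x` and EVERY exterior `η` the big-cube mean of the radius-`r₀` classical centre response obeys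
`kerE^η_R(cr₁^{(r₀)}) ≤ K/β + K'·cr₁^{(R)}(η)` (local equipartition at the centre + classical domination; at `η = 𝟙` an `R`-UNIFORM local thermal
ceiling).  Then for `0 < C_s`, `K'·C_s ≤ C₁`, `A₂ > 0` there is `β₂ ≥ 1` such that the flat cold-wall split inequality holds for all `β ≥ β₂`, `r₀ ≤ R`,
`R + 1 ≤ ⌈β^θ⌉`, `q.1 < q.2`, `x` and EVERY `η` — window exponent `1/4` instead of g16's `1/8`.  (§4: `1/4` is the ceiling of the method class.) [folklore] -/
theorem coldWallSplitFlat_window_of_localResponseMean {θ : ℝ} (hθ : 0 < θ) (hθ₄ : θ < 1 / 4) (r₀ : ℕ) {C_s C₁ A₂ K K' β₀ : ℝ}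
    (hCs : 0 < C_s) (hC₁ : 0 < C₁) (hK : 0 ≤ K) (hK' : 0 ≤ K') (hCC : K' * C_s ≤ C₁) (hA₂ : 0 < A₂)
    (hLRM : ∀ β : ℝ, β₀ ≤ β → ∀ R : ℕ, r₀ ≤ R → R + 1 ≤ ⌈β ^ θ⌉₊ → ∀ (q : Fin 4 × Fin 4) (x : Fin 4 → ℤ), q.1 < q.2 →
      ∀ η : LGConfig 4 (Matrix.specialUnitaryGroup (Fin 2) ℂ),
        kerE (Matrix.specialUnitaryGroup (Fin 2) ℂ) (fundamentalLatticeRep 2) β (fun k => x k - (R + 1)) (2 * R + 3) η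
            (classicalResponse (fundamentalLatticeRep 2) (fun k => x k - (r₀ + 1)) (2 * r₀ + 3) q x 1) ≤
          K / β + K' * classicalResponse (fundamentalLatticeRep 2) (fun k => x k - (R + 1)) (2 * R + 3) q x 1 η) :
    ∃ β₂ : ℝ, 1 ≤ β₂ ∧ ∀ β : ℝ, β₂ ≤ β → ∀ R : ℕ, r₀ ≤ R → R + 1 ≤ ⌈β ^ θ⌉₊ → ∀ (q : Fin 4 × Fin 4) (x : Fin 4 → ℤ), q.1 < q.2 →
      ∀ η : LGConfig 4 (Matrix.specialUnitaryGroup (Fin 2) ℂ),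
        (R : ℝ) ^ 4 / C₁ * |kerE (Matrix.specialUnitaryGroup (Fin 2) ℂ) (fundamentalLatticeRep 2) β (fun k => x k - (R + 1)) (2 * R + 3) η
              (plane (Matrix.specialUnitaryGroup (Fin 2) ℂ) (fundamentalLatticeRep 2) q x) -
            kerE (Matrix.specialUnitaryGroup (Fin 2) ℂ) (fundamentalLatticeRep 2) β (fun k => x k - (R + 1)) (2 * R + 3) 1
              (plane (Matrix.specialUnitaryGroup (Fin 2) ℂ) (fundamentalLatticeRep 2) q x)| ≤
          A₂ + carrierCl (fundamentalLatticeRep 2) C_s 1 1 R q x η := by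
  -- the local slop plus the thermal constant `K`, in tolerance units, is eventually below `C₁ A₂` on the window
  obtain ⟨b₁, hb₁1, hslop⟩ := localSlop_le_of_window hθ hθ₄ (K₀ := K + 120 * ((2 * r₀ + 3 : ℕ) : ℝ) ^ 4 * 38)
    (K₁ := 120 * ((2 * r₀ + 3 : ℕ) : ℝ) ^ 4 * 12) (K := C₁ * A₂) (by positivity) (by positivity) (mul_pos hC₁ hA₂)
  refine ⟨max b₁ β₀, hb₁1.trans (le_max_left _ _), fun β hβ R hr hR q x hq η => ?_⟩
  have hβb : b₁ ≤ β := (le_max_left _ _).trans hβ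
  have hβ₀ : β₀ ≤ β := (le_max_right _ _).trans hβ
  have hβ1 : 1 ≤ β := hb₁1.trans hβb
  have hβ0 : 0 < β := by linarith
  refine coldWallSplitFlat_inequality_of_localBudget hβ1 hC₁ hr q x η ?_
  set cr : ℝ := classicalResponse (fundamentalLatticeRep 2) (fun k => x k - ((R : ℤ) + 1)) (2 * R + 3) q x 1 η with hcrdef
  have hcr0 : 0 ≤ cr := classicalResponse_nonneg _ _ q x one_pos η
  -- the two mean local responses, by the hypothesis (at `η` and at `𝟙`, where the big response vanishes)
  have hAη := hLRM β hβ₀ R hr hR q x hq η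
  have hA1 := hLRM β hβ₀ R hr hR q x hq (1 : LGConfig 4 (Matrix.specialUnitaryGroup (Fin 2) ℂ))
  rw [classicalResponse_one (r := fundamentalLatticeRep 2) q hq (by rw [depth_centred]; omega) one_pos le_rfl, mul_zero, add_zero] at hA1
  have hmax : max (kerE (Matrix.specialUnitaryGroup (Fin 2) ℂ) (fundamentalLatticeRep 2) β (fun k => x k - (R + 1)) (2 * R + 3) η
            (classicalResponse (fundamentalLatticeRep 2) (fun k => x k - (r₀ + 1)) (2 * r₀ + 3) q x 1))
          (kerE (Matrix.specialUnitaryGroup (Fin 2) ℂ) (fundamentalLatticeRep 2) β (fun k => x k - (R + 1)) (2 * R + 3) 1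
            (classicalResponse (fundamentalLatticeRep 2) (fun k => x k - (r₀ + 1)) (2 * r₀ + 3) q x 1)) ≤ K / β + K' * cr :=
    max_le hAη (hA1.trans (le_add_of_nonneg_right (mul_nonneg hK' hcr0)))
  -- the slop side
  have hs := hslop β hβb R hR
  have hR0 : 0 ≤ (R : ℝ) ^ 4 := by positivity
  have hRC : 0 ≤ (R : ℝ) ^ 4 / C₁ := by positivity
  have e1 : (R : ℝ) ^ 4 / C₁ * (K / β + 120 * ((2 * r₀ + 3 : ℕ) : ℝ) ^ 4 * ((38 + 12 * Real.log β) / β)) =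
      (R : ℝ) ^ 4 * ((K + 120 * ((2 * r₀ + 3 : ℕ) : ℝ) ^ 4 * 38 + 120 * ((2 * r₀ + 3 : ℕ) : ℝ) ^ 4 * 12 * Real.log β) / β) / C₁ := by
    field_simp
    ring
  have h1 : (R : ℝ) ^ 4 / C₁ * (K / β + 120 * ((2 * r₀ + 3 : ℕ) : ℝ) ^ 4 * ((38 + 12 * Real.log β) / β)) ≤ A₂ := by
    rw [e1, div_le_iff₀ hC₁]
    linarith
  -- the classical side: `(R⁴/C₁)·K'·cr ≤ (R⁴/C_s)·cr = carrierCl C_s 1 1 R q x η`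
  have h2 : (R : ℝ) ^ 4 / C₁ * (K' * cr) ≤ carrierCl (fundamentalLatticeRep 2) C_s 1 1 R q x η := by
    unfold carrierCl
    rw [← hcrdef]
    have hcoef : (R : ℝ) ^ 4 / C₁ * K' ≤ 1 * (R : ℝ) ^ 4 / C_s := by
      rw [one_mul, div_mul_eq_mul_div, div_le_div_iff₀ hC₁ hCs]
      nlinarith [mul_le_mul_of_nonneg_left hCC hR0]
    calc (R : ℝ) ^ 4 / C₁ * (K' * cr) = ((R : ℝ) ^ 4 / C₁ * K') * cr := by ring
      _ ≤ (1 * (R : ℝ) ^ 4 / C_s) * cr := mul_le_mul_of_nonneg_right hcoef hcr0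
  calc (R : ℝ) ^ 4 / C₁ * (max (kerE (Matrix.specialUnitaryGroup (Fin 2) ℂ) (fundamentalLatticeRep 2) β (fun k => x k - (R + 1)) (2 * R + 3) η
            (classicalResponse (fundamentalLatticeRep 2) (fun k => x k - (r₀ + 1)) (2 * r₀ + 3) q x 1))
          (kerE (Matrix.specialUnitaryGroup (Fin 2) ℂ) (fundamentalLatticeRep 2) β (fun k => x k - (R + 1)) (2 * R + 3) 1
            (classicalResponse (fundamentalLatticeRep 2) (fun k => x k - (r₀ + 1)) (2 * r₀ + 3) q x 1)) +
          120 * ((2 * r₀ + 3 : ℕ) : ℝ) ^ 4 * ((38 + 12 * Real.log β) / β))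
      ≤ (R : ℝ) ^ 4 / C₁ * ((K / β + K' * cr) + 120 * ((2 * r₀ + 3 : ℕ) : ℝ) ^ 4 * ((38 + 12 * Real.log β) / β)) := by
        gcongr
    _ = (R : ℝ) ^ 4 / C₁ * (K / β + 120 * ((2 * r₀ + 3 : ℕ) : ℝ) ^ 4 * ((38 + 12 * Real.log β) / β)) +
          (R : ℝ) ^ 4 / C₁ * (K' * cr) := by ring
    _ ≤ A₂ + carrierCl (fundamentalLatticeRep 2) C_s 1 1 R q x η := add_le_add h1 h2

/-! ### The zero-temperature skeleton of (CW♭): at every FIXED cube and exterior the inequality holds eventually in `β`, with `C_s = C₁` and ANY `A₂ > 0` -/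

section Skeleton

variable {G : Type} [Group G] [TopologicalSpace G] [IsTopologicalGroup G] [CompactSpace G] [MeasurableSpace G] [BorelSpace G]
  (r : LatticeRep G)

/-- **Zero-temperature skeleton (every compact `G`).**  For a cube `(c, b)`, a plaquette `(x, q)` with `q.1 < q.2` at depth `≥ 2`, a tilt `0 < s ≤ 1`,
EVERY exterior `η` and every `ε > 0`: eventually in `β`,
`|kerE^η_β(plane q x) − kerE^𝟙_β(plane q x)| ≤ classicalResponse_s(η) + ε`
(the tree's Laplace step `kerE_plane_eventually_ge_sub_classicalResponse` at `η` and at `𝟙`, where the response vanishes, plus `kerE(plane) ≤ N`).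
The femto-tail stub is the UNIFORM version (in `η`, and in `R` coupled to `β`); any counterexample must be a moving family `(η_β, R_β)`. [folklore] -/
theorem abs_kerE_plane_sub_eventually_le (c : Fin 4 → ℤ) (b : ℕ) (q : Fin 4 × Fin 4) (hq : q.1 < q.2) (x : Fin 4 → ℤ)
    (hx : 2 ≤ depth c b x) {s : ℝ} (hs : 0 < s) (hs1 : s ≤ 1) (η : LGConfig 4 G) {ε : ℝ} (hε : 0 < ε) :
    ∀ᶠ β : ℝ in atTop, |kerE G r β c b η (plane G r q x) - kerE G r β c b 1 (plane G r q x)| ≤ classicalResponse r c b q x s η + ε := by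
  have hη := kerE_plane_eventually_ge_sub_classicalResponse (r := r) c b q x hs η hε
  have h1 := kerE_plane_eventually_ge_sub_classicalResponse (r := r) c b q x hs (1 : LGConfig 4 G) hε
  filter_upwards [hη, h1] with β hβη hβ1
  rw [classicalResponse_one (r := r) q hq hx hs hs1] at hβ1
  have huη : kerE G r β c b η (plane G r q x) ≤ r.N := by
    have h := (kerE_deficit_mem_Icc (r := r) β c b η q x).1
    rw [kerE_const_sub (r := r) β c b η (continuous_plane r q x) (r.N : ℝ)] at h
    linarith
  have hu1 : kerE G r β c b 1 (plane G r q x) ≤ r.N := by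
    have h := (kerE_deficit_mem_Icc (r := r) β c b (1 : LGConfig 4 G) q x).1
    rw [kerE_const_sub (r := r) β c b (1 : LGConfig 4 G) (continuous_plane r q x) (r.N : ℝ)] at h
    linarith
  have hcr : 0 ≤ classicalResponse r c b q x s η := classicalResponse_nonneg c b q x hs η
  rw [abs_le]
  constructor <;> linarith

end Skeleton

/-- **(CW♭) AT EVERY FIXED `(R, q, x, η)`, EVENTUALLY IN `β`, WITH `C_s = C₁` AND ANY `A₂ > 0`** (`SU(2)`; the stub's own letters at a frozen cube and
exterior): `∀ᶠ β, (R⁴/C₁)|kerE^η(plane q x) − kerE^𝟙(plane q x)| ≤ A₂ + carrierCl C₁ 1 1 R q x η`.  What the femto tail adds is ONLY uniformity: the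
onset `β₂` must not depend on `η`, and `R` ranges up to `ℓ₂/uRec β`. [folklore] -/
theorem coldWallSplitFlat_eventually_fixed {C₁ A₂ : ℝ} (hC₁ : 0 < C₁) (hA₂ : 0 < A₂) (R : ℕ) (q : Fin 4 × Fin 4) (hq : q.1 < q.2)
    (x : Fin 4 → ℤ) (η : LGConfig 4 (Matrix.specialUnitaryGroup (Fin 2) ℂ)) :
    ∀ᶠ β : ℝ in atTop,
      (R : ℝ) ^ 4 / C₁ * |kerE (Matrix.specialUnitaryGroup (Fin 2) ℂ) (fundamentalLatticeRep 2) β (fun k => x k - (R + 1)) (2 * R + 3) η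
            (plane (Matrix.specialUnitaryGroup (Fin 2) ℂ) (fundamentalLatticeRep 2) q x) -
          kerE (Matrix.specialUnitaryGroup (Fin 2) ℂ) (fundamentalLatticeRep 2) β (fun k => x k - (R + 1)) (2 * R + 3) 1
            (plane (Matrix.specialUnitaryGroup (Fin 2) ℂ) (fundamentalLatticeRep 2) q x)| ≤
        A₂ + carrierCl (fundamentalLatticeRep 2) C₁ 1 1 R q x η := by
  have hR4 : 0 ≤ (R : ℝ) ^ 4 := by positivity
  set ε : ℝ := C₁ * A₂ / ((R : ℝ) ^ 4 + 1) with hεdef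
  have hε : 0 < ε := by rw [hεdef]; positivity
  have hx : 2 ≤ depth (fun k => x k - ((R : ℤ) + 1)) (2 * R + 3) x := by rw [depth_centred]; omega
  have hev := abs_kerE_plane_sub_eventually_le (fundamentalLatticeRep 2) (fun k => x k - ((R : ℤ) + 1)) (2 * R + 3) q hq x hx one_pos le_rfl η hε
  filter_upwards [hev] with β hβ
  have hRC : 0 ≤ (R : ℝ) ^ 4 / C₁ := by positivity
  have h1 := mul_le_mul_of_nonneg_left hβ hRC
  have h2 : (R : ℝ) ^ 4 / C₁ * ε ≤ A₂ := by
    rw [hεdef, div_mul_div_comm, div_le_iff₀ (by positivity)]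
    nlinarith
  have h3 : (R : ℝ) ^ 4 / C₁ * classicalResponse (fundamentalLatticeRep 2) (fun k => x k - ((R : ℤ) + 1)) (2 * R + 3) q x 1 η =
      carrierCl (fundamentalLatticeRep 2) C₁ 1 1 R q x η := by
    unfold carrierCl
    ring
  calc (R : ℝ) ^ 4 / C₁ * |kerE (Matrix.specialUnitaryGroup (Fin 2) ℂ) (fundamentalLatticeRep 2) β (fun k => x k - (R + 1)) (2 * R + 3) η
            (plane (Matrix.specialUnitaryGroup (Fin 2) ℂ) (fundamentalLatticeRep 2) q x) -
          kerE (Matrix.specialUnitaryGroup (Fin 2) ℂ) (fundamentalLatticeRep 2) β (fun k => x k - (R + 1)) (2 * R + 3) 1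
            (plane (Matrix.specialUnitaryGroup (Fin 2) ℂ) (fundamentalLatticeRep 2) q x)|
      ≤ (R : ℝ) ^ 4 / C₁ * (classicalResponse (fundamentalLatticeRep 2) (fun k => x k - ((R : ℤ) + 1)) (2 * R + 3) q x 1 η + ε) := h1
    _ = (R : ℝ) ^ 4 / C₁ * classicalResponse (fundamentalLatticeRep 2) (fun k => x k - ((R : ℤ) + 1)) (2 * R + 3) q x 1 η +
          (R : ℝ) ^ 4 / C₁ * ε := by ring
    _ ≤ carrierCl (fundamentalLatticeRep 2) C₁ 1 1 R q x η + A₂ := by rw [h3]; exact add_le_add le_rfl h2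
    _ = A₂ + carrierCl (fundamentalLatticeRep 2) C₁ 1 1 R q x η := add_comm _ _

end Summit.QuantumFields.YangMills.Cruxes.UVSeamRec.ClassicalResponse.ColdWall

end
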